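import Summits.QuantumFields.YangMills.Theorems.BalabanUVNodesK0S5FarSlotWeighted
import Summits.QuantumFields.YangMills.Theorems.BalabanUVNodesK0S5NearClassSocket
import Summits.QuantumFields.YangMills.Theorems.BalabanUVNodesN07LocalLettersHBAtCubeDomains
import HarnessLib

/-!
# K0⁷ `stub_prop8StepCoP13` (stmt-QuantumFields-20541), S5 → S6 junction — **THE `HB`-LETTERS OF (165) WITH THE FAR DATUM IN PRINT'S LETTERS (NO COLLAR IN THE CONSTANTS)**: dag-n07-w4's
# three `HB`-summand doors `letters10On_HB_of_core_adm22_T4` (p602860) ∕ `letters10On_HB_cubeDomains_box` (p604811) ∕ `…_of_centred` (p608218) re-run BY NAME on this seat's far-weighted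
# S5 socket `K0S5FarSlotWeighted.hbRows164_core_of_adm22_T4_farCollar` ([Balaban1985Variational] p. 303, (161) line 3 → 4: the cube size `M = M′R₁M₁` of the far datum (155) is absorbed
# by the collar distance, `M ≤ d(y₁,y₂) + M_Δ`), so that a far size PROPORTIONAL TO (collar + cube) — what (145)–(146)∕(151) deliver at the record — leaves `C_d`, `θ` free of `ρ`

Cell `pub-ymgap`, width seat `pub-ymgap-k0-s1-w3` gen 5 (HUMAN RULING D-0149; START LIST v11 §k0-s1; bus CLAIM-2 of g5).  `--kind proof --supports stmt-QuantumFields-20541 --as helper`;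
count-neutral; def-free; compositions BY NAME of landed theorems (dag-n07-w4 `letters10On_extension_of_weightedRowsTop` p601315, `near_of_centred_box` p606564, dag-n07-e 39b
`adm22_cubeDomains` ∕ `inOm_top_cubeDomains_of_mem_box` p600410, k0-s1-w3 P13 `hcollar_cubeDomains` p603650, FILE 1 `hbRows164_core_of_adm22_T4_farCollar`); nothing restated; dag-n07-w4's
three doors are the UNWEIGHTED twins (far `‖B c‖ ≤ C_d·M_Δ·ε(j)·L^{k−j}`, resp. `‖B c‖ ≤ β₂` with `θ·(β₂∕M)`), different statements, both kept.

WHY.  Print p. 301 (145)–(146): on the window `□̃` of the collared cube the generalized axial gauge with centre `y` gives *«|Ū′ᵏ(x,x′) − 1| < |x − y|2L²ε₀ ≦ 4d(M + R₁M₁)L²ε₀ ≦ 8dL²Mε₀»*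
and *«|Ū′ʲ(x,x′) − 1| < 11d²ε₀ + 8dL²Mε₀»* on every `□̃^{(j)}`, `j ≤ k` — the far datum (151)∕(155) is UNIFORM and PROPORTIONAL TO THE WINDOW (`M + R₁M₁`: cube plus collar); p. 303 (161)
line 4 then spends the collar distance `R₁M₁ ≤ d(y₁,y₂)` of the far cells to write it as `(d(y₁,y₂) + M_Δ)·18d²L³ε₀`, and line 5 absorbs `d + M_Δ ≤ M_Δ(d + 1)` into `B₃`'s weight
(162) — so (164)'s far member is `¼M_Δ·½ε₀` with NO `R₁M₁`.  In the tree the unweighted doors can take such a datum only with `C_d ∝ ρ` or `θ ∝ ρ`, turning the displayed (163)-row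
`8C_dCB₃e^{−δ₁ρ} ≤ θ` into a `ρe^{−δ₁ρ}`-threshold; with FILE 1's socket the same datum enters as `C_d·ε·L^{k−j}·(ρ + M_Δ)` and the constants stay collar-free.

WHAT IS PROVED (sorry-free; axioms standard; no definition).  §1 ★★ `letters10On_HB_of_core_adm22_T4_farCollar (F N)` — any admissible `D`, any window `Y` of top-domain sites whose bonds see
the lower cells at `distBI ≥ R′ ≥ 0`: near `‖B c‖ ≤ C_d·M_Δ·ε₁·(distBI + 1)`, FAR `‖B c‖ ≤ C_d·ε(j(c))·L^{K−n−j(c)}·(R′ + M_Δ)` (`1 ≤ M_Δ`, `0 ≤ ε(j)` below the top), `8C_dCB₃e^{−δ₁R′} ≤ θ` ⇒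
`Letters10On Y η_{K−n} t (H_V B)` for every `t > ¼M_Δ·max{4C_dCB₃ε₁, θ·ε(K−n)}`.  §2 ★★ `letters10On_HB_cubeDomains_box_farCollar (F N)` — at `D := cubeDomains (F.P K) a M ρ (K − n) hk`,
`Y := π '' box L a M (K − n)`, `R′ := ρ` (39b + P13 discharge admissibility, top membership, collar): far `‖B c‖ ≤ C_d·ε(j(c))·L^{K−n−j(c)}·(ρ + M_Δ)`.  ★★★ `letters10On_HB_cubeDomains_box_of_centred_farCollar
(F N)` — BOTH sizes in print's own shapes and NO collar in the constants: near CENTRED `‖B c‖ ≤ β₁·(dist_k(c₋, Bᵏ(π x_c)) + 1)` at a point `x_c ∈ □` ((160)), far UNIFORM `‖B c‖ ≤ β₂·(ρ + M)`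
((145)–(146)∕(155)) ⇒ `Letters10On (π '' □) η_{K−n} t (H_V B)` for every `t > ¼·M·max{4CB₃β₁, θ·β₂}` provided `8CB₃e^{−δ₁ρ} ≤ θ` (v1.2's conclusion had `θ·(β₂∕M)` for far `‖B c‖ ≤ β₂`).
§3 ★★ `letters10On_HB_of_core_adm22_T4_nearClassW (F N)` — the same composition on FILE 3's socket with a CONSUMER-CHOSEN near class `near : BondIdx D → Prop` (print's (150) split: top cube at
levels `k` and `k − 1`): near `‖B c‖ ≤ C_d·M_Δ·ε₁·L^{K−n−j(c)}·(distBI + 1)`, far `R′ ≤ distBI ∧ ‖B c‖ ≤ C_d·M_Δ·ε(j(c))·L^{K−n−j(c)}·(distBI + 1)`.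
HONEST SCOPE: compositions of landed theorems; the data sizes (BRIDGE-92: dag-n07-e module 40 ∕ dag-n07-w5 crossing bonds ∕ the far producer (146) — UNOWNED at filing), the kernel formula of
`H_V`, the numerics (N1 `numerics_propCubeP`, `exists_rho_h163`) and non-wrapping stay HYPOTHESES; ONE of the three summands of (159); nothing of [15]∕[6]∕[B6-II] asserted; the tokens
`LocalLetters165∕167TopStep(Core)` NOT discharged; `stub_prop8StepCoP13` ∕ K0⁷ ∕ K1⁷ NOT closed; N07 NOT discharged (5∕27 unmoved); one finite 𝕋⁴ programme at fixed ε — R4 closes the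
conditional finite-𝕋⁴ rung `BalabanLadder.UV` ONLY; the YM mass gap (Clay) is NOT proved by any of this; nothing continuum ∕ ℝ⁴ ∕ OS.  No `def`, no `instance`, no `notation`, no `sorry`.

References: T. Bałaban, CMP **102** (1985) 277–309 [Balaban1985Variational] (144) p.300, (145)–(151) p.301, (155) p.302, (159)–(163) p.303, (164)–(165) p.304; CMP **99** (1985) 75–102
[Balaban1985RegularSpaces] (1.131) pp.98–99, (1.140) p.100; CMP **96** (1984) 223–250 [Balaban1984PropagatorsII] (2.1)–(2.2) p.224, (2.60) p.234.
-/

set_option autoImplicit false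

noncomputable section

open scoped BigOperators Matrix.Norms.L2Operator

namespace Summit.QuantumFields.YangMills.Theorems.K0S5FarCollarLetters

open Literature.MathematicalPhysics.QuantumFieldTheory.Balaban1983to89
open Literature.MathematicalPhysics.QuantumFieldTheory.Balaban1983to89.Node00
open B15Eq112TorusCover (cover)
open B14DomainGeom (Pt)
open B8Eq131Cubes (box cube)
open B11Eq115Space (levOf)
open B6SectADomainsV1 (Domains)
open B6SectAOperatorsV1 (BondIdx)
open T4Continuum (T4Family)
open B5Eq117TorusCarriers (Mk)
open B5Eq118OneStroke (iterBlockOf)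
open B5Prop12FieldsLattice (distSite)
open Summit.QuantumFields.YangMills.Theorems.FlatCubeOpsText (Adm22 distBI)
open Summit.QuantumFields.YangMills.Theorems.K0FlatCubeOpsTextP (IsLevWeight flatH)
open Summit.QuantumFields.YangMills.Theorems.K0S5CollarCubeDomains (hcollar_cubeDomains)
open Summit.QuantumFields.YangMills.Theorems.K0S5FarSlotWeighted (hbRows164_core_of_adm22_T4_farCollar)
open Summit.QuantumFields.YangMills.Theorems.K0S5NearClassSocket (hbRows164_core_of_adm22_T4_nearClassW)
open Summit.QuantumFields.YangMills.BalabanUVNodes.N07CubeDomainsAdm22 (adm22_cubeDomains inOm_top_cubeDomains_of_mem_box)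
open Summit.QuantumFields.YangMills.BalabanUVNodes.N07HalvingStepTopOfLocalLetters (Letters10On)
open Summit.QuantumFields.YangMills.BalabanUVNodes.N07Letters10OfExtension (letters10On_extension_of_weightedRowsTop)
open Summit.QuantumFields.YangMills.BalabanUVNodes.N07NearDataOfCentre (near_of_centred_box)

/-! ## §1 The `HB` letters on any window of top-level sites, any admissible tower — far datum in print's letters `C_d·ε(j)·L^{k−j}·(R′ + M_Δ)` -/

open scoped Classical in
/-- ★★ **[15] (164) ⇒ THE THREE (165)-LETTERS OF `HB = H_V B`, FAR DATUM IN PRINT'S LETTERS** — dag-n07-w4's `letters10On_HB_of_core_adm22_T4` (p602860) with the S5 socket P12 replaced by this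
seat's `K0S5FarSlotWeighted.hbRows164_core_of_adm22_T4_farCollar`: binder block identical except `1 ≤ M_Δ`, `0 ≤ R′`, the lower radii `0 ≤ ε(j)` (`j < K − n`), and the FAR size
`‖B c‖ ≤ C_d·ε(j(c))·L^{K−n−j(c)}·(R′ + M_Δ)` ((155)'s `18d²L³ε₀·M`, `M = M′R₁M₁`; at the record `∝ (ρ + M)·ε₀` by (145)–(146)); conclusion unchanged: `Letters10On Y η_{K−n} t (H_V B)` for every
`t > ¼M_Δ·max{4C_dCB₃ε₁, θ·ε(K − n)}` — `C_d`, `θ` FREE OF THE COLLAR, the (163)-row `8C_dCB₃e^{−δ₁R′} ≤ θ` as in N1's `exists_rho_h163`.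
[cite: Balaban1985Variational, (155) p.302, (160)–(161) p.303, (163)–(165) p.304; Balaban1984PropagatorsII, (2.1)–(2.2) p.224, (2.60) p.234; Balaban1985RegularSpaces, (1.140) p.100] -/
theorem letters10On_HB_of_core_adm22_T4_farCollar (F : T4Family) (N : ℕ) [NeZero N] :
    ∃ (Mh₀ R₀ : ℕ) (C δ₀ δ₁ B₃ : ℝ), 0 ≤ C ∧ 0 < δ₀ ∧ 0 < δ₁ ∧ 0 < B₃ ∧
    ∀ (n K : ℕ) (_ : 1 ≤ K - n) (_ : K - n + 1 ≤ F.m + K) {Mh R a' : ℕ} (_ : Mh = F.L ^ a') (_ : Mh₀ ≤ Mh) (_ : R₀ ≤ R) (_ : a' + 3 ≤ F.m + n)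
      (D : Domains (F.P K)) (_ : D.k = K - n) (_ : Adm22 D R (F.L * Mh))
      (w : ℕ → PBond (F.P K) 0 → ℝ) (_ : IsLevWeight (F.P K) (K - n) D w)
      {Cd MΔ ε₁ θ R' : ℝ} {ε : ℕ → ℝ}
      (_ : 0 ≤ Cd) (_ : 1 ≤ MΔ) (_ : 0 ≤ ε₁) (_ : 0 ≤ ε (K - n)) (_ : ∀ j, j < K - n → 0 ≤ ε j) (_ : ∀ j, j < K - n → ε j ≤ 2 * ε (j + 1))
      (_ : 0 ≤ R') (_ : 8 * Cd * C * B₃ * Real.exp (-(δ₁ * R')) ≤ θ)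
      {Y : Set (Site (F.P K) 0)} (_ : ∀ x ∈ Y, D.InOm (K - n) x)
      (_ : ∀ b : PBond (F.P K) 0, b.src ∈ Y → ∀ c : BondIdx D, (c.1.1 : ℕ) < K - n → R' ≤ distBI D b c)
      {HV : (BondIdx D → MatA N) →ₗ[ℂ] (PBond (F.P K) 0 → MatA N)}
      (_ : ∀ (A : BondIdx D → MatA N) (b : PBond (F.P K) 0), HV A b = ∑ c, ((flatH (F.P K) (K - n) D (Pi.single c 1) b : ℝ) : ℂ) • A c)
      {B : BondIdx D → MatA N}
      (_ : ∀ b : PBond (F.P K) 0, b.src ∈ Y → ∀ c : BondIdx D, (c.1.1 : ℕ) = K - n → ‖B c‖ ≤ Cd * MΔ * ε₁ * (distBI D b c + 1))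
      (_ : ∀ c : BondIdx D, (c.1.1 : ℕ) < K - n → ‖B c‖ ≤ Cd * ε (c.1.1 : ℕ) * ((F.P K).L : ℝ) ^ ((K - n) - (c.1.1 : ℕ)) * (R' + MΔ))
      {t : ℝ} (_ : 1 / 4 * MΔ * max (4 * Cd * C * B₃ * ε₁) (θ * ε (K - n)) < t),
      Letters10On Y ((F.P K).eta (K - n)) t (HV B) := by
  obtain ⟨Mh₀, R₀, C, δ₀, δ₁, B₃, hC, hδ₀, hδ₁, hB₃, hmain⟩ := hbRows164_core_of_adm22_T4_farCollar F
  refine ⟨Mh₀, R₀, C, δ₀, δ₁, B₃, hC, hδ₀, hδ₁, hB₃, ?_⟩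
  intro n K hk1 hk' Mh R a' hMha hMh hR hsize D hDk hAdm w hw Cd MΔ ε₁ θ R' ε hCd hMΔ hε₁ hεk hεpos hcomp hR' h163 Y hY hcollar HV hHv B hBnear hBfar
    t ht
  have hq : 0 ≤ 1 / 4 * MΔ * max (4 * Cd * C * B₃ * ε₁) (θ * ε (K - n)) :=
    mul_nonneg (mul_nonneg (by norm_num) (zero_le_one.trans hMΔ)) (le_max_of_le_left (by positivity))
  refine letters10On_extension_of_weightedRowsTop hDk hw hY hq ht (flatH (F.P K) (K - n) D) hHv fun X hX b hb => ?_
  have hrows := hmain n K hk1 hk' hMha hMh hR hsize D hDk hAdm w hw hCd hMΔ hε₁ hεk hεpos hcomp hR' h163 (X := X) (b := b) (hY b.src hb)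
    (hcollar b hb) (fun c hc => (hX c).trans (hBnear b hb c hc)) (fun c hc => (hX c).trans (hBfar c hc))
  exact ⟨hrows.1, hrows.2.1, hrows.2.2.1⟩

/-! ## §2 At the torus family `Node00.cubeDomains` of a print datum's own tower, window `π '' □`, collar `R′ := ρ` (39b + P13, as in dag-n07-w4's v1) -/

open scoped Classical in
/-- ★★ **THE `HB`-LETTERS ON THE GRID CUBE OF A PRINT DATUM, FAR DATUM IN PRINT'S LETTERS** — dag-n07-w4's `letters10On_HB_cubeDomains_box` (p604811) with §1 in place of p602860: at
`D := cubeDomains (F.P K) a M ρ (K − n) hk`, `Y := π '' box L a M (K − n)`, the collar is `ρ ≤ distBI` (k0-s1-w3 P13 `hcollar_cubeDomains`), so the far size reads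
`‖B c‖ ≤ C_d·ε(j(c))·L^{K−n−j(c)}·(ρ + M_Δ)` — proportional to (collar + cube letter), which is what (145)–(146)∕(151) deliver at the record — and the conclusion `t > ¼M_Δ·max{4C_dCB₃ε₁, θ·ε(K−n)}`
with `8C_dCB₃e^{−δ₁ρ} ≤ θ` carries NO `ρ` in `C_d`, `θ`. [cite: Balaban1985Variational, p.302 («we take □ as this big cube»), (155) p.302, (160)–(161) p.303, (163)–(165) p.304; Balaban1985RegularSpaces, (1.131) pp.98–99; Balaban1984PropagatorsII, (2.1)–(2.2) p.224, (2.60) p.234] -/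
theorem letters10On_HB_cubeDomains_box_farCollar (F : T4Family) (N : ℕ) [NeZero N] :
    ∃ (Mh₀ R₀ : ℕ) (C δ₀ δ₁ B₃ : ℝ), 0 ≤ C ∧ 0 < δ₀ ∧ 0 < δ₁ ∧ 0 < B₃ ∧
    ∀ (n K : ℕ) (_ : 1 ≤ K - n) (_ : K - n + 1 ≤ F.m + K) (hk : K - n ≤ (F.P K).m + (F.P K).K)
      {Mh R a' : ℕ} (_ : Mh = F.L ^ a') (_ : Mh₀ ≤ Mh) (_ : R₀ ≤ R) (_ : a' + 3 ≤ F.m + n)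
      {a : Pt (F.P K).d} {M ρ : ℕ}
      (_ : F.L * Mh ∣ ρ) (_ : ∀ i, ((F.L * Mh : ℕ) : ℤ) ∣ a i) (_ : F.L * Mh ∣ M) (_ : F.L * Mh ∣ (F.P K).sitesPerDir (K - n)) (_ : R * (F.L * Mh) ≤ ρ)
      (_ : Set.InjOn (cover (F.P K)) (cube (F.P K).L a M ρ (K - n) 0))
      {Cd MΔ ε₁ θ : ℝ} {ε : ℕ → ℝ}
      (_ : 0 ≤ Cd) (_ : 1 ≤ MΔ) (_ : 0 ≤ ε₁) (_ : 0 ≤ ε (K - n)) (_ : ∀ j, j < K - n → 0 ≤ ε j) (_ : ∀ j, j < K - n → ε j ≤ 2 * ε (j + 1))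
      (_ : 8 * Cd * C * B₃ * Real.exp (-(δ₁ * (ρ : ℝ))) ≤ θ)
      {HV : (BondIdx (cubeDomains (F.P K) a M ρ (K - n) hk) → MatA N) →ₗ[ℂ] (PBond (F.P K) 0 → MatA N)}
      (_ : ∀ (A : BondIdx (cubeDomains (F.P K) a M ρ (K - n) hk) → MatA N) (b : PBond (F.P K) 0),
        HV A b = ∑ c, ((flatH (F.P K) (K - n) (cubeDomains (F.P K) a M ρ (K - n) hk) (Pi.single c 1) b : ℝ) : ℂ) • A c)
      {B : BondIdx (cubeDomains (F.P K) a M ρ (K - n) hk) → MatA N}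
      (_ : ∀ b : PBond (F.P K) 0, b.src ∈ cover (F.P K) '' box (F.P K).L a M (K - n) →
        ∀ c : BondIdx (cubeDomains (F.P K) a M ρ (K - n) hk), (c.1.1 : ℕ) = K - n →
          ‖B c‖ ≤ Cd * MΔ * ε₁ * (distBI (cubeDomains (F.P K) a M ρ (K - n) hk) b c + 1))
      (_ : ∀ c : BondIdx (cubeDomains (F.P K) a M ρ (K - n) hk), (c.1.1 : ℕ) < K - n →
        ‖B c‖ ≤ Cd * ε (c.1.1 : ℕ) * ((F.P K).L : ℝ) ^ ((K - n) - (c.1.1 : ℕ)) * ((ρ : ℝ) + MΔ))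
      {t : ℝ} (_ : 1 / 4 * MΔ * max (4 * Cd * C * B₃ * ε₁) (θ * ε (K - n)) < t),
      Letters10On (cover (F.P K) '' box (F.P K).L a M (K - n)) ((F.P K).eta (K - n)) t (HV B) := by
  obtain ⟨Mh₀, R₀, C, δ₀, δ₁, B₃, hC, hδ₀, hδ₁, hB₃, hmain⟩ := letters10On_HB_of_core_adm22_T4_farCollar F N
  refine ⟨Mh₀, R₀, C, δ₀, δ₁, B₃, hC, hδ₀, hδ₁, hB₃, ?_⟩
  intro n K hk1 hk' hk Mh R a' hMha hMh hR hsize a M ρ hρ ha hM hper hRρ hinj Cd MΔ ε₁ θ ε hCd hMΔ hε₁ hεk hεpos hcomp h163 HV hHv B hBnear hBfar t ht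
  -- `1 ≤ L·M_h`
  have hM₁ : 1 ≤ F.L * Mh := by
    rw [hMha]
    exact Nat.one_le_iff_ne_zero.mpr (Nat.mul_ne_zero (by have := F.hL11; omega) (pow_ne_zero _ (by have := F.hL11; omega)))
  have hLP : (F.P K).L = F.L := rfl
  -- the family, its admissibility (39b), the canonical level weights
  have hAdm : Adm22 (cubeDomains (F.P K) a M ρ (K - n) hk) R (F.L * Mh) :=
    adm22_cubeDomains (P := F.P K) hM₁ hρ (by simpa [hLP] using ha) hM hper hRρ
  have hw : IsLevWeight (F.P K) (K - n) (cubeDomains (F.P K) a M ρ (K - n) hk)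
      (fun m b => (((F.P K).L : ℝ) ^ levOf (fun j => {x : Site (F.P K) 0 | (cubeDomains (F.P K) a M ρ (K - n) hk).InOm j x}) (K - n) b.src *
        (((F.P K).L : ℝ)⁻¹) ^ (K - n)) ^ m) := fun _ _ => rfl
  -- the window lies over `Ω_k` (39b) and sees the lower cells at `distBI ≥ ρ` (P13)
  have hY : ∀ x ∈ cover (F.P K) '' box (F.P K).L a M (K - n), (cubeDomains (F.P K) a M ρ (K - n) hk).InOm (K - n) x := by
    rintro _ ⟨x, hx, rfl⟩
    exact inOm_top_cubeDomains_of_mem_box hinj hk1 hx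
  have hcol : ∀ b : PBond (F.P K) 0, b.src ∈ cover (F.P K) '' box (F.P K).L a M (K - n) →
      ∀ c : BondIdx (cubeDomains (F.P K) a M ρ (K - n) hk), (c.1.1 : ℕ) < K - n →
        (ρ : ℝ) ≤ distBI (cubeDomains (F.P K) a M ρ (K - n) hk) b c := by
    intro b hb c hc
    have h := hcollar_cubeDomains (hk := hk) b hb c (by simpa using hc)
    simpa using h
  exact hmain n K hk1 hk' hMha hMh hR hsize (cubeDomains (F.P K) a M ρ (K - n) hk) rfl hAdm _ hw hCd hMΔ hε₁ hεk hεpos hcomp (Nat.cast_nonneg ρ) h163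
    hY hcol hHv hBnear hBfar ht

open scoped Classical in
/-- ★★★ **THE SAME WITH BOTH DATA SIZES IN PRINT'S OWN SHAPES AND NO COLLAR IN THE CONSTANTS** — (160) CENTRED at a point `x_c` of the window on the top cells (`‖B c‖ ≤ β₁·(dist_k(c₋, Bᵏ(π x_c)) + 1)`,
dag-n07-w4's `near_of_centred_box` ⇒ the socket's near hypothesis with `M_Δ := M`), and below the top a UNIFORM far size PROPORTIONAL TO THE WINDOW, `‖B c‖ ≤ β₂·(ρ + M)` ((145)–(146)∕(151)∕(155):
`|B| < 18d²L³Mε₀` with `M = M′R₁M₁` — collar plus cube): then `Letters10On (π '' □) η_{K−n} t (H_V B)` for every `t > ¼·M·max{4CB₃β₁, θ·β₂}` provided `8CB₃e^{−δ₁ρ} ≤ θ` — §2 at `C_d := 1`,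
`M_Δ := M`, `ε₁ := β₁`, `ε ≡ β₂`.  Compare v1.2 `letters10On_HB_cubeDomains_box_of_centred` (far `‖B c‖ ≤ β₂`, conclusion `θ·(β₂∕M)`): there a far size `∝ (ρ + M)` leaves `θ ∝ ρ` against
`e^{−δ₁ρ}`; here `ρ` is gone from both constants ((161) line 4: `M ≤ d(y₁,y₂) + M_Δ`). [cite: Balaban1985Variational, (145)–(146) p.301, (155) p.302, (160)–(161) p.303, (163)–(165) p.304] -/
theorem letters10On_HB_cubeDomains_box_of_centred_farCollar (F : T4Family) (N : ℕ) [NeZero N] :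
    ∃ (Mh₀ R₀ : ℕ) (C δ₀ δ₁ B₃ : ℝ), 0 ≤ C ∧ 0 < δ₀ ∧ 0 < δ₁ ∧ 0 < B₃ ∧
    ∀ (n K : ℕ) (_ : 1 ≤ K - n) (_ : K - n + 1 ≤ F.m + K) (hk : K - n ≤ (F.P K).m + (F.P K).K)
      {Mh R a' : ℕ} (_ : Mh = F.L ^ a') (_ : Mh₀ ≤ Mh) (_ : R₀ ≤ R) (_ : a' + 3 ≤ F.m + n)
      {a : Pt (F.P K).d} {M ρ : ℕ} (_ : 1 ≤ M)
      (_ : F.L * Mh ∣ ρ) (_ : ∀ i, ((F.L * Mh : ℕ) : ℤ) ∣ a i) (_ : F.L * Mh ∣ M) (_ : F.L * Mh ∣ (F.P K).sitesPerDir (K - n)) (_ : R * (F.L * Mh) ≤ ρ)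
      (_ : Set.InjOn (cover (F.P K)) (cube (F.P K).L a M ρ (K - n) 0))
      {xc : Pt (F.P K).d} (_ : xc ∈ box (F.P K).L a M (K - n))
      {β₁ β₂ θ : ℝ} (_ : 0 ≤ β₁) (_ : 0 ≤ β₂) (_ : 8 * C * B₃ * Real.exp (-(δ₁ * (ρ : ℝ))) ≤ θ)
      {HV : (BondIdx (cubeDomains (F.P K) a M ρ (K - n) hk) → MatA N) →ₗ[ℂ] (PBond (F.P K) 0 → MatA N)}
      (_ : ∀ (A : BondIdx (cubeDomains (F.P K) a M ρ (K - n) hk) → MatA N) (b : PBond (F.P K) 0),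
        HV A b = ∑ c, ((flatH (F.P K) (K - n) (cubeDomains (F.P K) a M ρ (K - n) hk) (Pi.single c 1) b : ℝ) : ℂ) • A c)
      {B : BondIdx (cubeDomains (F.P K) a M ρ (K - n) hk) → MatA N}
      (_ : ∀ c : BondIdx (cubeDomains (F.P K) a M ρ (K - n) hk), (c.1.1 : ℕ) = K - n →
        ‖B c‖ ≤ β₁ * (distSite (Mk (F.P K) (c.1.1 : ℕ)) c.1.2.src (iterBlockOf (c.1.1 : ℕ) (cover (F.P K) xc)) + 1))
      (_ : ∀ c : BondIdx (cubeDomains (F.P K) a M ρ (K - n) hk), (c.1.1 : ℕ) < K - n → ‖B c‖ ≤ β₂ * ((ρ : ℝ) + M))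
      {t : ℝ} (_ : 1 / 4 * (M : ℝ) * max (4 * C * B₃ * β₁) (θ * β₂) < t),
      Letters10On (cover (F.P K) '' box (F.P K).L a M (K - n)) ((F.P K).eta (K - n)) t (HV B) := by
  obtain ⟨Mh₀, R₀, C, δ₀, δ₁, B₃, hC, hδ₀, hδ₁, hB₃, hmain⟩ := letters10On_HB_cubeDomains_box_farCollar F N
  refine ⟨Mh₀, R₀, C, δ₀, δ₁, B₃, hC, hδ₀, hδ₁, hB₃, ?_⟩
  intro n K hk1 hk' hk Mh R a' hMha hMh hR hsize a M ρ hM hρ ha hMd hper hRρ hinj xc hxc β₁ β₂ θ hβ₁ hβ₂ h163 HV hHv B hX₁ hX₂ t ht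
  have hMr : (1 : ℝ) ≤ M := by exact_mod_cast hM
  have hL1 : (1 : ℝ) ≤ ((F.P K).L : ℝ) := by exact_mod_cast (F.P K).L_pos
  -- the near hypothesis from the centred bound (`M_Δ := M`), the far one from `L^{k−j} ≥ 1`
  have hnear := near_of_centred_box (cubeDomains (F.P K) a M ρ (K - n) hk) (a := a) (M := M) hk hM hxc hβ₁ hX₁
  refine hmain n K hk1 hk' hk hMha hMh hR hsize hρ ha hMd hper hRρ hinj (Cd := 1) (MΔ := (M : ℝ)) (ε₁ := β₁) (θ := θ)
    (ε := fun _ => β₂) zero_le_one hMr hβ₁ hβ₂ (fun _ _ => hβ₂) (fun _ _ => by linarith)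
    (by simpa using h163) hHv (fun b hb c hc => ?_) (fun c hc => ?_) (by simpa using ht)
  · have h := hnear b hb c hc
    calc ‖B c‖ ≤ β₁ * M * (distBI (cubeDomains (F.P K) a M ρ (K - n) hk) b c + 1) := h
      _ = 1 * (M : ℝ) * β₁ * (distBI (cubeDomains (F.P K) a M ρ (K - n) hk) b c + 1) := by ring
  · have hpow : (1 : ℝ) ≤ ((F.P K).L : ℝ) ^ ((K - n) - (c.1.1 : ℕ)) := one_le_pow₀ hL1
    have hρM : (0 : ℝ) ≤ (ρ : ℝ) + M := by positivity
    calc ‖B c‖ ≤ β₂ * ((ρ : ℝ) + M) := hX₂ c hc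
      _ ≤ β₂ * ((F.P K).L : ℝ) ^ ((K - n) - (c.1.1 : ℕ)) * ((ρ : ℝ) + M) :=
          mul_le_mul_of_nonneg_right (le_mul_of_one_le_right hβ₂ hpow) hρM
      _ = 1 * β₂ * ((F.P K).L : ℝ) ^ ((K - n) - (c.1.1 : ℕ)) * ((ρ : ℝ) + M) := by rw [one_mul]

/-! ## §3 The `HB` letters with a CONSUMER-CHOSEN near class (FILE 3's socket): any admissible tower, any window of top-domain sites -/

open scoped Classical in
/-- ★★ **[15] (164) ⇒ THE THREE (165)-LETTERS OF `HB = H_V B`, NEAR CLASS A PREDICATE** — §1's composition run on `K0S5NearClassSocket.hbRows164_core_of_adm22_T4_nearClassW`: for a predicate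
`near` on the cells of `D` (print's (150) split: the top cube's cells at levels `k` AND `k − 1`; ym3-torus's interior class: top bonds with both ends in `□_k`), NEAR `‖B c‖ ≤
C_d·M_Δ·ε₁·L^{K−n−j(c)}·(distBI + 1)`, FAR `R′ ≤ distBI` ∧ `‖B c‖ ≤ C_d·M_Δ·ε(j(c))·L^{K−n−j(c)}·(distBI + 1)` at every bond based in the window `Y` ⇒ `Letters10On Y η_{K−n} t (H_V B)` for every
`t > ¼M_Δ·max{4C_dCB₃ε₁, θ·ε(K − n)}`. [cite: Balaban1985Variational, (147)–(150) p.301, (155) p.302, (160)–(161) p.303, (163)–(165) p.304; Balaban1985RegularSpaces, (1.140) p.100] -/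
theorem letters10On_HB_of_core_adm22_T4_nearClassW (F : T4Family) (N : ℕ) [NeZero N] :
    ∃ (Mh₀ R₀ : ℕ) (C δ₀ δ₁ B₃ : ℝ), 0 ≤ C ∧ 0 < δ₀ ∧ 0 < δ₁ ∧ 0 < B₃ ∧
    ∀ (n K : ℕ) (_ : 1 ≤ K - n) (_ : K - n + 1 ≤ F.m + K) {Mh R a' : ℕ} (_ : Mh = F.L ^ a') (_ : Mh₀ ≤ Mh) (_ : R₀ ≤ R) (_ : a' + 3 ≤ F.m + n)
      (D : Domains (F.P K)) (_ : D.k = K - n) (_ : Adm22 D R (F.L * Mh))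
      (w : ℕ → PBond (F.P K) 0 → ℝ) (_ : IsLevWeight (F.P K) (K - n) D w)
      {Cd MΔ ε₁ θ R' : ℝ} {ε : ℕ → ℝ}
      (_ : 0 ≤ Cd) (_ : 0 ≤ MΔ) (_ : 0 ≤ ε₁) (_ : 0 ≤ ε (K - n)) (_ : ∀ j, j < K - n → ε j ≤ 2 * ε (j + 1))
      (_ : 8 * Cd * C * B₃ * Real.exp (-(δ₁ * R')) ≤ θ)
      (near : BondIdx D → Prop) {Y : Set (Site (F.P K) 0)} (_ : ∀ x ∈ Y, D.InOm (K - n) x)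
      (_ : ∀ b : PBond (F.P K) 0, b.src ∈ Y → ∀ c : BondIdx D, ¬ near c → R' ≤ distBI D b c)
      {HV : (BondIdx D → MatA N) →ₗ[ℂ] (PBond (F.P K) 0 → MatA N)}
      (_ : ∀ (A : BondIdx D → MatA N) (b : PBond (F.P K) 0), HV A b = ∑ c, ((flatH (F.P K) (K - n) D (Pi.single c 1) b : ℝ) : ℂ) • A c)
      {B : BondIdx D → MatA N}
      (_ : ∀ b : PBond (F.P K) 0, b.src ∈ Y → ∀ c : BondIdx D, near c →
        ‖B c‖ ≤ Cd * MΔ * ε₁ * ((F.P K).L : ℝ) ^ ((K - n) - (c.1.1 : ℕ)) * (distBI D b c + 1))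
      (_ : ∀ b : PBond (F.P K) 0, b.src ∈ Y → ∀ c : BondIdx D, ¬ near c →
        ‖B c‖ ≤ Cd * MΔ * ε (c.1.1 : ℕ) * ((F.P K).L : ℝ) ^ ((K - n) - (c.1.1 : ℕ)) * (distBI D b c + 1))
      {t : ℝ} (_ : 1 / 4 * MΔ * max (4 * Cd * C * B₃ * ε₁) (θ * ε (K - n)) < t),
      Letters10On Y ((F.P K).eta (K - n)) t (HV B) := by
  obtain ⟨Mh₀, R₀, C, δ₀, δ₁, B₃, hC, hδ₀, hδ₁, hB₃, hmain⟩ := hbRows164_core_of_adm22_T4_nearClassW F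
  refine ⟨Mh₀, R₀, C, δ₀, δ₁, B₃, hC, hδ₀, hδ₁, hB₃, ?_⟩
  intro n K hk1 hk' Mh R a' hMha hMh hR hsize D hDk hAdm w hw Cd MΔ ε₁ θ R' ε hCd hMΔ hε₁ hεk hcomp h163 near Y hY hcollar HV hHv B hBnear hBfar t ht
  have hq : 0 ≤ 1 / 4 * MΔ * max (4 * Cd * C * B₃ * ε₁) (θ * ε (K - n)) :=
    mul_nonneg (mul_nonneg (by norm_num) hMΔ) (le_max_of_le_left (by positivity))
  refine letters10On_extension_of_weightedRowsTop hDk hw hY hq ht (flatH (F.P K) (K - n) D) hHv fun X hX b hb => ?_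
  have hrows := hmain n K hk1 hk' hMha hMh hR hsize D hDk hAdm w hw hCd hMΔ hε₁ hεk hcomp h163 near (X := X) (b := b) (hY b.src hb)
    (hcollar b hb) (fun c hc => (hX c).trans (hBnear b hb c hc)) (fun c hc => (hX c).trans (hBfar b hb c hc))
  exact ⟨hrows.1, hrows.2.1, hrows.2.2.1⟩

end Summit.QuantumFields.YangMills.Theorems.K0S5FarCollarLetters

end
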